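import Literature.NumberTheory.Automorphic.Liu2021.LemD1AsPrinted
import Literature.RepresentationTheory.Liu2021.GlobalOscillatorIsomorphismCriterion
import Mathlib.RepresentationTheory.Intertwining
import HarnessLib

/-!
# [Liu 2021, App. D, Lemma D.1 (1) ∧ (3)] AS PRINTED ⟹ the local injectivity input of Thm. 4.18 (2)'s proof
# («Statement (2) follows from Lemma D.1»), over the tree's REAL local family `LemD1Family`

Y. Liu, *Fourier–Jacobi cycles and arithmetic relative trace formula*, Camb. J. Math. **9** (2021) 1–147 =
arXiv:2102.11518 [Liu2021]; `l. NNNN` = lines of the author's TeX `FJcycle.tex` (md5 `6db49a74122d2cb0f224fa1b39488a0c`),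
as in `Liu2021/LemD1AsPrinted.lean` and `Literature/RepresentationTheory/Liu2021/GlobalOscillatorIsomorphismCriterion.lean`.

## What this file is, and why (the one missing link of the Δ2 bridge's `hsepW` cite leg)

[Liu2021] Thm. 4.18 (2) (l. 2241: «The `ℂ[𝔾(𝔸_F^∞)]`-modules in the direct sum in Theorem 4.18 are mutually
non-isomorphic») is proved in ONE printed sentence (l. 2270): «Statement (2) follows from Lemma D.1» — i.e. from the LOCAL
Lemma D.1 (3) (l. 5233): «If `n ≥ 3`, then `ω(μ', ε', χ')` is isomorphic to `ω(μ, ε, χ)` if and only if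
`(μ', ε', χ') = (μ, ε, χ)`», through «`ω(μ, ε, χ) := ⊗'_v ω(μ_v, ε_v, χ_v)`» (Def. 4.11, l. 2092–2096).  The tree holds

* the local-to-global PASSAGE, proved in the kernel over ABSTRACT local data:
  `Literature.RepresentationTheory.Liu2021.eq_of_equiv` (`GlobalOscillatorIsomorphismCriterion.lean`) and its consumer-shaped
  twin `Liu2021.Prop413Data.admTriple_eq_of_areIsomorphic_of_local` (`Liu2021/Prop413MultLeOneOfAsPrinted.lean`, Appendix) —
  both take the local injectivity `hD : ∀ v a b, Nonempty ((ω v a).Equiv (ω v b)) → a = b` and the irreducibility of the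
  local factors `[∀ v a, (ω v a).IsIrreducible]` as HYPOTHESES;
* Lemma D.1 (1)–(4) EXACTLY AS PRINTED over the tree's REAL local data: `LemD1_1AsPrinted` ∕ `LemD1Family.Item1AsPrinted` and
  `LemD1_3AsPrinted (Lf : LemD1Family F E n)` (`Liu2021/LemD1AsPrinted.lean` §1–§2), whose «isomorphic» is the predicate
  `AreIsomorphicRep` (READING L7 = READING R6 of `Thm418AsPrinted`) and whose «`ε' = ε`» is `LemD1.SameClass` on
  representatives (READING L3′).

This file PROVES that the second supplies the first: for `n ≥ 3`, Lemma D.1 (1) ∧ (3) AS PRINTED for the family `Lf` give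
(§2) the irreducibility of every `ω(μ, ε, χ)` of the family and (§3–§4) the injectivity of the local parameter
`(μ, [ε], χ) ↦ [ω(μ, ε, χ)]` in EXACTLY the `hD` shape, the class `[ε] ∈ E^{−×}/Nm_{E/F} E^×` being the `Quot` of
`LemD1.SameClass` (no new definition: the local parameter type is written out as
`LemD1.MuSet S × Quot LemD1.SameClass × LemD1.ChiSet S`, and `ω` is evaluated at the representative `Quot.out`).  §1 is the
bookkeeping identification of READING L7∕R6 «isomorphic» (`AreIsomorphicRep`, an `∃` over `ℂ`-linear equivalences) with Mathlib's
bundled `Representation.Equiv` — `AreIsomorphicRep` had no consumer in the tree before this file.  §5 assembles, for a family of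
places `v`, the GLOBAL statement in the shape of the Δ2 junction's binder `hsepW`
(`Summits/HodgeConjecture/CorCM/D2Bridge/HcmPieces.lean`, `thm418Combined_of_asPrinted_resolved_of_decomposition`): global
summands `Ω t` of a group `G` receiving the local groups `U(V)(F_v) →* G`, LOCALLY ISOTYPIC of type `ω(μ_v, [ε_v], χ_v)` at the
local component `loc t v` of `t` (this is what «`⊗'_v`» of Def. 4.11 provides — for genuine restricted tensor products it is the
tree theorem `IsRestrictedTensorProductRep.isotypicComponent_eq_top`; it is the ONE input left to the model side), with `loc`
injective («a triple is determined by its local components»), are pairwise non-isomorphic — from Lemma D.1 (1) ∧ (3) AS PRINTED at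
every place and NOTHING ELSE of App. D.

THEOREMS ONLY: no definition, no named fact, no `sorry`; nothing of Liu's PROOF of Lemma D.1 (Howe duality, theta dichotomy) is
formalised or asserted — Lemma D.1 enters only as the hypotheses `Item1AsPrinted` ∕ `LemD1_3AsPrinted` (`Prop`s on the consumer's
OWN local data).  Cell pub-hodgecm2 (COR-CM), Δ2 BRIDGE cite leg `hsepW` (assembler DECISION #3, HOME/INBOX l. 10797); seat
prover-pub-hodgecm2-b10-g67-0.  HC_CM is NOT proved; «Δ2 BRIDGE CLOSED» is NOT claimed; nothing about the model's Weil carriers is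
constructed here.

## References

* [Liu2021] Y. Liu, Camb. J. Math. 9 (2021) = arXiv:2102.11518 — Def. 4.11 (l. 2083–2097); Thm. 4.18 (2) and its proof
  (l. 2241, 2270); App. D §D.1 (l. 5213–5224), Lemma D.1 (l. 5226–5237), esp. (1) (l. 5229) and (3) (l. 5233).
* [FlathCorvallis1979] D. Flath, *Decomposition of representations into tensor products*, Proc. Sympos. Pure Math. 33.1
  (1979) 179–183, Thm. 3 (uniqueness clause) — through `GlobalOscillatorIsomorphismCriterion.lean`.
* [Bump1997] D. Bump, *Automorphic Forms and Representations* (CUP 1997), §3.4 Prop. 3.4.1 — idem.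
-/

noncomputable section

open scoped MonoidAlgebra

namespace Literature.NumberTheory.Automorphic.Liu2021

open Literature.RepresentationTheory.CentralCharacterQuotient (augmentation)

/-! ## §1 READING L7 ∕ R6 «isomorphic `ℂ[G]`-modules» is Mathlib's `Representation.Equiv` -/

section AreIsomorphic

variable {G : Type*} [Group G] {V₁ V₂ V₃ : Type*} [AddCommGroup V₁] [Module ℂ V₁] [AddCommGroup V₂] [Module ℂ V₂]
  [AddCommGroup V₃] [Module ℂ V₃] {ρ₁ : Representation ℂ G V₁} {ρ₂ : Representation ℂ G V₂}
  {ρ₃ : Representation ℂ G V₃}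

/-- «isomorphic» in the sense of [Liu2021] (READING L7 of `LemD1AsPrinted`, READING R6 of `Thm418AsPrinted`: an intertwining
`ℂ`-linear equivalence exists) yields a Mathlib `Representation.Equiv`. [cite: Liu2021, App. D Lemma D.1 (2)–(4) and Thm. 4.18 (2)] -/
theorem AreIsomorphicRep.nonempty_equiv (h : AreIsomorphicRep ρ₁ ρ₂) : Nonempty (ρ₁.Equiv ρ₂) := by
  obtain ⟨f, hf⟩ := h
  exact ⟨Representation.Equiv.mk f fun g => LinearMap.ext (hf g)⟩

/-- A Mathlib `Representation.Equiv` is an isomorphism in the sense of [Liu2021] (READING L7 ∕ R6).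
[cite: Liu2021, App. D Lemma D.1 (2)–(4) and Thm. 4.18 (2)] -/
theorem areIsomorphicRep_of_equiv (e : ρ₁.Equiv ρ₂) : AreIsomorphicRep ρ₁ ρ₂ :=
  ⟨e.toLinearEquiv, fun g v => by
    rw [Representation.Equiv.toLinearEquiv_apply, Representation.Equiv.toLinearEquiv_apply]
    exact e.toIntertwiningMap.isIntertwining _ _ g v⟩

/-- **READING L7 ∕ R6 = Mathlib**: `AreIsomorphicRep ρ₁ ρ₂ ↔ Nonempty (ρ₁.Equiv ρ₂)`.
[cite: Liu2021, App. D Lemma D.1 (2)–(4) and Thm. 4.18 (2)] -/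
theorem areIsomorphicRep_iff_nonempty_equiv : AreIsomorphicRep ρ₁ ρ₂ ↔ Nonempty (ρ₁.Equiv ρ₂) :=
  ⟨AreIsomorphicRep.nonempty_equiv, fun ⟨e⟩ => areIsomorphicRep_of_equiv e⟩

/-- «isomorphic» is reflexive. [cite: Liu2021, App. D Lemma D.1 (3)] -/
theorem AreIsomorphicRep.refl (ρ₁ : Representation ℂ G V₁) : AreIsomorphicRep ρ₁ ρ₁ :=
  areIsomorphicRep_of_equiv (Representation.Equiv.refl ρ₁)

/-- «isomorphic» is symmetric. [cite: Liu2021, App. D Lemma D.1 (3)] -/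
theorem AreIsomorphicRep.symm (h : AreIsomorphicRep ρ₁ ρ₂) : AreIsomorphicRep ρ₂ ρ₁ := by
  obtain ⟨e⟩ := h.nonempty_equiv
  exact areIsomorphicRep_of_equiv e.symm

/-- «isomorphic» is transitive. [cite: Liu2021, App. D Lemma D.1 (3)] -/
theorem AreIsomorphicRep.trans (h₁₂ : AreIsomorphicRep ρ₁ ρ₂) (h₂₃ : AreIsomorphicRep ρ₂ ρ₃) : AreIsomorphicRep ρ₁ ρ₃ := by
  obtain ⟨e₁₂⟩ := h₁₂.nonempty_equiv
  obtain ⟨e₂₃⟩ := h₂₃.nonempty_equiv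
  exact areIsomorphicRep_of_equiv (e₁₂.trans e₂₃)

end AreIsomorphic

/-! ## §2–§4 Lemma D.1 (1) ∧ (3) AS PRINTED at ONE place: irreducible local factors and the injective local parameter -/

namespace LemD1Family

variable {F E : Type} [Field F] [ValuativeRel F] [TopologicalSpace F] [CommRing E] [Algebra F E]
  [TopologicalSpace E] [IsTopologicalRing E] {n : ℕ} {Lf : LemD1Family F E n}

/-- **Lemma D.1, first sentence + (1), family form, `n ≥ 3`: every `ω(μ, ε, χ)` of the family is (non-zero and) irreducible
in Mathlib's sense** — the instance `[∀ a, (ω a).IsIrreducible]` the local-to-global passage asks for.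
[cite: Liu2021, App. D Lemma D.1 (1) (l. 5226–5229)] -/
theorem Item1AsPrinted.isIrreducible_quot_of_three_le (h1 : Lf.Item1AsPrinted) (hn : 3 ≤ n) (μ : LemD1.MuSet Lf.S)
    (e : LemD1.EpsRep Lf.S) (χ : LemD1.ChiSet Lf.S) : (Lf.quot μ e χ).IsIrreducible :=
  (h1 μ e χ).isIrreducible_of_three_le hn

/-- **Lemma D.1 (3) AS PRINTED, read on a Mathlib `Representation.Equiv`**: for `n ≥ 3`, an equivalence
`ω(μ', ε', χ') ≃ ω(μ, ε, χ)` forces `μ' = μ`, `ε' = ε` in `E^{−×}/Nm E^×` (`SameClass` of the representatives) and `χ' = χ`.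
[cite: Liu2021, App. D Lemma D.1 (3) (l. 5233)] -/
theorem param_eq_of_equiv (h3 : LemD1_3AsPrinted Lf) (hn : 3 ≤ n) {μ μ' : LemD1.MuSet Lf.S} {e e' : LemD1.EpsRep Lf.S}
    {χ χ' : LemD1.ChiSet Lf.S} (f : (Lf.quot μ' e' χ').Equiv (Lf.quot μ e χ)) :
    μ' = μ ∧ LemD1.SameClass e e' ∧ χ' = χ :=
  (h3 hn μ μ' e e' χ χ').1 (areIsomorphicRep_of_equiv f)

/-- Lemma D.1 (3), converse direction as printed («if and only if»): equal parameters — the representatives of `ε` in the same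
class — give isomorphic `ω`'s, as a Mathlib `Representation.Equiv`. [cite: Liu2021, App. D Lemma D.1 (3) (l. 5233)] -/
theorem nonempty_equiv_of_sameClass (h3 : LemD1_3AsPrinted Lf) (hn : 3 ≤ n) (μ : LemD1.MuSet Lf.S) {e e' : LemD1.EpsRep Lf.S}
    (he : LemD1.SameClass e e') (χ : LemD1.ChiSet Lf.S) : Nonempty ((Lf.quot μ e' χ).Equiv (Lf.quot μ e χ)) :=
  ((h3 hn μ μ e e' χ χ).2 ⟨rfl, he, rfl⟩).nonempty_equiv

/-- **Lemma D.1 (3) on the CLASS of `ε`**: for `n ≥ 3`, an equivalence `ω(μ', ε', χ') ≃ ω(μ, ε, χ)` forces equality of the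
classes of the representatives in `Quot LemD1.SameClass` (= `E^{−×}/Nm_{E/F} E^×`, READING L3′), by `Quot.sound`.
[cite: Liu2021, App. D Lemma D.1 (3) (l. 5233) and §D.1 Step 1 (l. 5217)] -/
theorem quotMk_eq_of_equiv (h3 : LemD1_3AsPrinted Lf) (hn : 3 ≤ n) {μ μ' : LemD1.MuSet Lf.S} {e e' : LemD1.EpsRep Lf.S}
    {χ χ' : LemD1.ChiSet Lf.S} (f : (Lf.quot μ' e' χ').Equiv (Lf.quot μ e χ)) :
    Quot.mk (LemD1.SameClass (S := Lf.S)) e = Quot.mk (LemD1.SameClass (S := Lf.S)) e' :=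
  Quot.sound (param_eq_of_equiv h3 hn f).2.1

/-- **THE LOCAL INJECTIVITY `hD` (the input of `Literature.RepresentationTheory.Liu2021.eq_of_equiv` and of
`Prop413Data.admTriple_eq_of_areIsomorphic_of_local`) FROM LEMMA D.1 (3) AS PRINTED.**  Local parameters are triples
`a = (μ, [ε], χ)` with `[ε] : Quot LemD1.SameClass` the class of a representative; `ω(a) := ω(μ, [ε].out, χ)` is the family's
`χ`-quotient at the chosen representative `Quot.out`.  For `n ≥ 3`: `ω(a) ≃ ω(b) ⟹ a = b`.
[cite: Liu2021, App. D Lemma D.1 (3) (l. 5233) and §D.1 Steps 1–3 (l. 5217–5221)] -/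
theorem localParam_eq_of_nonempty_equiv (h3 : LemD1_3AsPrinted Lf) (hn : 3 ≤ n)
    (a b : LemD1.MuSet Lf.S × Quot (LemD1.SameClass (S := Lf.S)) × LemD1.ChiSet Lf.S)
    (h : Nonempty ((Lf.quot a.1 a.2.1.out a.2.2).Equiv (Lf.quot b.1 b.2.1.out b.2.2))) : a = b := by
  obtain ⟨f⟩ := h
  obtain ⟨hμ, he, hχ⟩ := param_eq_of_equiv (μ := b.1) (μ' := a.1) (e := b.2.1.out) (e' := a.2.1.out) (χ := b.2.2)
    (χ' := a.2.2) h3 hn f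
  have hq : a.2.1 = b.2.1 := by
    have hba : Quot.mk (LemD1.SameClass (S := Lf.S)) b.2.1.out = Quot.mk (LemD1.SameClass (S := Lf.S)) a.2.1.out :=
      Quot.sound he
    rw [Quot.out_eq, Quot.out_eq] at hba
    exact hba.symm
  exact Prod.ext hμ (Prod.ext hq hχ)

/-- The same with Lemma D.1 (1) supplying the non-vanishing: for `n ≥ 3` the hypothesis «`ω(a) ≠ 0`» of the isomorphism
criteria never bites (bookkeeping twin of `Item1AsPrinted.nontrivial_of_three_le` at the class parameter).
[cite: Liu2021, App. D Lemma D.1 (1) (l. 5229)] -/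
theorem Item1AsPrinted.nontrivial_quot_localParam (h1 : Lf.Item1AsPrinted) (hn : 3 ≤ n)
    (a : LemD1.MuSet Lf.S × Quot (LemD1.SameClass (S := Lf.S)) × LemD1.ChiSet Lf.S) :
    Nontrivial (Lf.V a.1 a.2.1.out ⧸ augmentation (Lf.omega a.1 a.2.1.out) Lf.S.scalar a.2.2.1) :=
  h1.nontrivial_of_three_le hn a.1 a.2.1.out a.2.2

/-- … and the irreducibility instance at the class parameter. [cite: Liu2021, App. D Lemma D.1 (1) (l. 5226–5229)] -/
theorem Item1AsPrinted.isIrreducible_quot_localParam (h1 : Lf.Item1AsPrinted) (hn : 3 ≤ n)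
    (a : LemD1.MuSet Lf.S × Quot (LemD1.SameClass (S := Lf.S)) × LemD1.ChiSet Lf.S) :
    (Lf.quot a.1 a.2.1.out a.2.2).IsIrreducible :=
  h1.isIrreducible_quot_of_three_le hn a.1 a.2.1.out a.2.2

end LemD1Family

/-! ## §5 «Statement (2) follows from Lemma D.1» (l. 2270): the GLOBAL non-isomorphy from Lemma D.1 (1) ∧ (3) AS PRINTED
at every place + local isotypy + «a triple is determined by its local components» -/

section Global

variable {ι : Type} {Fv Ev : ι → Type} [∀ v, Field (Fv v)] [∀ v, ValuativeRel (Fv v)] [∀ v, TopologicalSpace (Fv v)]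
  [∀ v, CommRing (Ev v)] [∀ v, Algebra (Fv v) (Ev v)] [∀ v, TopologicalSpace (Ev v)] [∀ v, IsTopologicalRing (Ev v)]
  {n : ℕ} (Lf : ∀ v, LemD1Family (Fv v) (Ev v) n)
  {G : Type*} [Group G] {T : Type*} {W : T → Type*} [∀ t, AddCommGroup (W t)] [∀ t, Module ℂ (W t)]

/-- **[Liu2021, Thm. 4.18 (2)] «follows from Lemma D.1» — the passage with Lemma D.1 (1) ∧ (3) AS PRINTED as the ONLY local
input.**  Data: places `v` with the local data of App. D §D.1 `Lf v : LemD1Family (F_v) (E_v) n` (Liu: `E_v = E ⊗_F F_v`, the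
hermitian space `V ⊗ F_v`); homomorphisms `φ v : U(V)(F_v) →* G` into the global group (Liu: `𝔾(F_v) ⊆ 𝔾(𝔸_F^∞)`); global
representations `Ω t` of `G` indexed by global parameters `t` (Liu: `ω(μ, ε, χ)`), with local components
`loc t v = (μ_v, [ε_v], χ_v)` — `loc` injective («`μ = ⊗ μ_v`», «`χ = ⊗ χ_v`», `ε = (ε_v)_v`, Def. 4.11).  Hypotheses:
Lemma D.1 (1) and (3) AS PRINTED at every place (`h1`, `h3`), `n ≥ 3`, and LOCAL ISOTYPY `hiso`: `Ω t` restricted to `U(V)(F_v)`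
is `ω(μ_v, [ε_v], χ_v)`-isotypic (what «`ω(μ,ε,χ) := ⊗'_v ω(μ_v,ε_v,χ_v)`» gives).  Conclusion: `Ω t ≃ Ω t'` with `Ω t ≠ 0`
forces `t = t'`. [cite: Liu2021, Thm. 4.18 (2) and its proof (l. 2241, 2270); Def. 4.11 (l. 2092–2096); App. D Lemma D.1 (1), (3) (l. 5229, 5233)]
[cite: FlathCorvallis1979, Theorem 3 (uniqueness clause)] -/
theorem eq_of_equiv_of_lemD1AsPrinted (h1 : ∀ v, (Lf v).Item1AsPrinted) (h3 : ∀ v, LemD1_3AsPrinted (Lf v)) (hn : 3 ≤ n)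
    (φ : ∀ v, ↥(Lf v).S.U →* G) (Ω : ∀ t, Representation ℂ G (W t))
    {loc : T → ∀ v, LemD1.MuSet (Lf v).S × Quot (LemD1.SameClass (S := (Lf v).S)) × LemD1.ChiSet (Lf v).S}
    (hloc : Function.Injective loc)
    (hiso : ∀ (t : T) (v : ι),
      isotypicComponent (MonoidAlgebra ℂ ↥(Lf v).S.U) (Representation.asModule ((Ω t).comp (φ v)))
        ((Lf v).quot (loc t v).1 (loc t v).2.1.out (loc t v).2.2).asModule = ⊤)
    {t t' : T} [Nontrivial (W t)] (e : (Ω t).Equiv (Ω t')) : t = t' := by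
  haveI : ∀ (v : ι) (a : LemD1.MuSet (Lf v).S × Quot (LemD1.SameClass (S := (Lf v).S)) × LemD1.ChiSet (Lf v).S),
      ((Lf v).quot a.1 a.2.1.out a.2.2).IsIrreducible :=
    fun v a => (h1 v).isIrreducible_quot_localParam hn a
  exact Literature.RepresentationTheory.Liu2021.eq_of_equiv φ hloc Ω
    (fun v (a : LemD1.MuSet (Lf v).S × Quot (LemD1.SameClass (S := (Lf v).S)) × LemD1.ChiSet (Lf v).S) =>
      (Lf v).quot a.1 a.2.1.out a.2.2)
    hiso (fun v a b hab => LemD1Family.localParam_eq_of_nonempty_equiv (h3 v) hn a b hab) e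

/-- **The Δ2 junction's binder `hsepW`, token for token** (`thm418Combined_of_asPrinted_resolved_of_decomposition`,
`Summits/HodgeConjecture/CorCM/D2Bridge/HcmPieces.lean`; also the `hsep` of `Prop413Data.rank_intertwiningMap_le_one_of_asPrinted`):
under the hypotheses of `eq_of_equiv_of_lemD1AsPrinted`, two summands `Ω s ≠ 0`, `Ω t` related by an intertwining `ℂ`-linear
equivalence have `s = t`. [cite: Liu2021, Thm. 4.18 (2) and its proof (l. 2241, 2270); App. D Lemma D.1 (1), (3) (l. 5229, 5233)] -/
theorem hsep_of_lemD1AsPrinted (h1 : ∀ v, (Lf v).Item1AsPrinted) (h3 : ∀ v, LemD1_3AsPrinted (Lf v)) (hn : 3 ≤ n)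
    (φ : ∀ v, ↥(Lf v).S.U →* G) (Ω : ∀ t, Representation ℂ G (W t))
    {loc : T → ∀ v, LemD1.MuSet (Lf v).S × Quot (LemD1.SameClass (S := (Lf v).S)) × LemD1.ChiSet (Lf v).S}
    (hloc : Function.Injective loc)
    (hiso : ∀ (t : T) (v : ι),
      isotypicComponent (MonoidAlgebra ℂ ↥(Lf v).S.U) (Representation.asModule ((Ω t).comp (φ v)))
        ((Lf v).quot (loc t v).1 (loc t v).2.1.out (loc t v).2.2).asModule = ⊤)
    (s t : T) (hs : Nontrivial (W s))
    (hst : ∃ f : W s ≃ₗ[ℂ] W t, ∀ (g : G) (x : W s), f (Ω s g x) = Ω t g (f x)) : s = t := by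
  obtain ⟨f, hf⟩ := hst
  haveI := hs
  exact eq_of_equiv_of_lemD1AsPrinted Lf h1 h3 hn φ Ω hloc hiso (Representation.Equiv.mk f fun g => LinearMap.ext (hf g))

end Global

end Literature.NumberTheory.Automorphic.Liu2021

end
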